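import Mathlib.Analysis.Complex.ExponentialBounds
import Mathlib.Analysis.Real.Pi.Bounds
import Literature.NumberTheory.Automorphic.ModularLambdaImaginaryAxis
import Literature.NumberTheory.Automorphic.ModularLambdaSurjective
import HarnessLib

/-!
# Javanpeykar's Lemma 4.4.1: `|q dλ/dq| ≥ 3/20` near `τ = i`, and `λ⁻¹([1/2, 2/3]) ⊂ i[4/5, 1]`

Ninth file on the modular `λ`-function (sequel of `ModularLambdaImaginaryAxis.lean`). We prove the
quantitative input about `λ` in the proof of A. Javanpeykar, *Polynomial bounds for Arakelov
invariants of Belyi curves*, Algebra & Number Theory **8** (2014), arXiv:1403.6404, §4.4–4.5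
(the bound for the archimedean contribution `-log ‖dπ_K‖_σ(σ(b))` to the height of a point `b`
over `a = n/(2n-1) ∈ [1/2, 2/3]` in Thm. 4.5.1 / 4.5.2):

* **Lemma 4.4.1** ("Let `λ(τ) = Σ aₙ qⁿ(τ)`, `q(τ) = e^{πiτ}`, be the `q`-expansion of `λ` on `ℍ`.
  Then, for any real number `4/5 ≤ y ≤ 1`, `-log |Σ n aₙ qⁿ(iy)| ≤ 2`."; proof: "It suffices to
  show that `|q dλ/dq| ≥ 3/20`"):
  `three_twentieths_le_thetaQuot` / `three_twentieths_le_norm_deriv_modularLambda_div_pi`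
  (`|q dλ/dq|(iy) = |λ'(iy)|/π = θ₂⁴θ₄⁴/θ₃⁴(iy) ≥ 3/20`),
  `neg_log_norm_deriv_modularLambda_div_pi_le` and, literally as printed with
  `aₙ = 16·(qExpansion 2 (λ/16))ₙ`, **`neg_log_norm_tsum_le_two`**;
* the location of `λ⁻¹(a)` for `a ∈ [1/2, 2/3]` used in the proof of Thm. 4.5.1 ("Note that
  `λ⁻¹(2/3) ≈ 0.85i`. In particular, `Im(λ⁻¹(a)) ≥ Im(λ⁻¹(2/3)) > s₁`", `s₁ = √(1/2)`), in the
  form needed to apply Lemma 4.4.1 there: `two_thirds_lt_modularLambda_re_four_fifths`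
  (`λ(4i/5) > 2/3`) and **`mem_Icc_of_modularLambda_re_mem_Icc`**
  (`y > 0`, `λ(iy) ∈ [1/2, 2/3] ⇒ y ∈ [4/5, 1]`; with `λ(i) = 1/2` and strict decrease).

## Proof

Not the paper's (which manipulates the product formula `λ = 16q ∏ ((1+q^{2n})/(1+q^{2n-1}))⁸`,
absent from Mathlib), but through the derivative formula `λ' = πi λ θ₄⁴` (tree,
`deriv_modularLambda_eq'`): `|q dλ/dq|(iy) = λ(iy) θ₄(iy)⁴ = θ₂⁴θ₄⁴/θ₃⁴ (iy)`, and the three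
thetanulls are bounded termwise on the axis (`u = e^{-πy}`): `θ₂(iy) ≥ 2e^{-πy/4}` (the terms
`n = 0, -1`), `θ₃(iy) ≤ 1 + 2u/(1 - u³)` (`e^{-πn²y} ≤ u^{3|n|-2}`), `θ₄(iy) ≥ 2 - θ₃(iy)`; with
`e^{-π} ≥ 0.043` and `0.080 ≤ e^{-4π/5} ≤ 0.082` this gives `θ₂⁴ ≥ 0.688`, `θ₃ ≤ 1.1641`,
`θ₄ ≥ 0.8359` on `4/5 ≤ y ≤ 1`, whence `θ₂⁴θ₄⁴/θ₃⁴ ≥ 0.18 > 3/20 > e^{-2}`, and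
`λ(4i/5) ≥ 16·0.08/1.1641⁴ > 2/3`.

Everything is proved; no definition and no named fact is introduced.

## References

* A. Javanpeykar, *Polynomial bounds for Arakelov invariants of Belyi curves* (appendix by
  P. Bruin), Algebra & Number Theory 8 (2014), no. 1, 89–140, doi:10.2140/ant.2014.8.89,
  arXiv:1403.6404: Lemma 4.4.1, proof of Thm. 4.5.1, Thm. 4.5.2. [Javanpeykar2014]
* E. T. Whittaker, G. N. Watson, *A Course of Modern Analysis*, 4th ed. (1927), §21.7–21.71
  (`λ`, `θ`-series).
-/

noncomputable section

open Complex Real Filter Topology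

open scoped Real

namespace Literature.NumberTheory.Automorphic

namespace ModularLambda

open Literature.NumberTheory.EllipticCurves.JacobiThetaNull

variable {y : ℝ}

/-! ### Real series for the thetanulls on the axis -/

/-- `θ₃(iy) = Σₙ e^{-πn²y}` as a real series for the real number `θ₃(iy)`. [folklore] -/
theorem hasSum_theta3_I_mul_re (hy : 0 < y) :
    HasSum (fun n : ℤ ↦ rexp (-π * (n : ℝ) ^ 2 * y)) (theta3 (I * y)).re := by
  have h := hasSum_theta3_I_mul hy
  rw [theta3_I_mul_eq_re hy] at h
  exact Complex.hasSum_ofReal.mp h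

/-- `θ₂(iy) = Σₙ e^{-π(n+½)²y}` as a real series for the real number `θ₂(iy)`. [folklore] -/
theorem hasSum_theta2_I_mul_re (hy : 0 < y) :
    HasSum (fun n : ℤ ↦ rexp (-π * ((n : ℝ) ^ 2 + n + 1 / 4) * y)) (theta2 (I * y)).re := by
  have h := hasSum_theta2_I_mul hy
  rw [theta2_I_mul_eq_re hy] at h
  exact Complex.hasSum_ofReal.mp h

/-- `θ₄(iy) = Σₙ Re(e^{πin - πn²y})` (the real parts of the terms of `θ(½, iy)`). [folklore] -/
theorem hasSum_theta4_I_mul_re (hy : 0 < y) :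
    HasSum (fun n : ℤ ↦ (jacobiTheta₂_term n (1 / 2 : ℂ) (I * y)).re) (theta4 (I * y)).re :=
  Complex.hasSum_re (hasSum_jacobiTheta₂_term (1 / 2 : ℂ) (im_I_mul_pos hy))

/-- The terms of `θ(½, iy)` have absolute value `e^{-πn²y}`. [folklore] -/
theorem norm_jacobiTheta₂_term_half_I_mul (n : ℤ) (y : ℝ) :
    ‖jacobiTheta₂_term n (1 / 2 : ℂ) (I * y)‖ = rexp (-π * (n : ℝ) ^ 2 * y) := by
  rw [norm_jacobiTheta₂_term]
  congr 1
  simp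

/-! ### Crude bounds: `θ₂ ≥ 2e^{-πy/4}`, `θ₃ ≤ 1 + 2u/(1 - u³)`, `θ₄ ≥ 2 - θ₃` (`u = e^{-πy}`) -/

/-- **`θ₂(iy) ≥ 2 e^{-πy/4}`** (the two terms `n = 0, -1`). [folklore] -/
theorem two_mul_exp_le_theta2_re (hy : 0 < y) :
    2 * rexp (-(π * y / 4)) ≤ (theta2 (I * y)).re := by
  have h := sum_le_hasSum ({0, -1} : Finset ℤ) (fun n _ ↦ (Real.exp_pos _).le)
    (hasSum_theta2_I_mul_re hy)
  rw [Finset.sum_pair (by norm_num)] at h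
  have e0 : rexp (-π * (((0 : ℤ) : ℝ) ^ 2 + ((0 : ℤ) : ℝ) + 1 / 4) * y) = rexp (-(π * y / 4)) := by
    congr 1; push_cast; ring
  have e1 : rexp (-π * (((-1 : ℤ) : ℝ) ^ 2 + ((-1 : ℤ) : ℝ) + 1 / 4) * y) =
      rexp (-(π * y / 4)) := by
    congr 1; push_cast; ring
  rw [e0, e1] at h
  linarith

/-- `e^{-πn²y} ≤ u^{3|n|-2}`, `u = e^{-πy}`, for `n ≠ 0` (`n² ≥ 3|n| - 2` for every integer).
[folklore] -/
theorem exp_sq_le_majorant (hy : 0 < y) {n : ℤ} (hn : n ≠ 0) :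
    rexp (-π * (n : ℝ) ^ 2 * y) ≤ rexp (-(π * y)) ^ (3 * n.natAbs - 2) := by
  rw [← Real.exp_nat_mul, Real.exp_le_exp]
  have h1 : 1 ≤ n.natAbs := Int.natAbs_pos.mpr hn
  have hcast : ((3 * n.natAbs - 2 : ℕ) : ℝ) = 3 * (n.natAbs : ℝ) - 2 := by
    rw [Nat.cast_sub (by omega)]
    push_cast
    ring
  have hsq : ((n.natAbs : ℝ)) ^ 2 = (n : ℝ) ^ 2 := by
    rw [Nat.cast_natAbs, Int.cast_abs, sq_abs]
  have hm : 3 * (n.natAbs : ℝ) - 2 ≤ (n.natAbs : ℝ) ^ 2 := by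
    rcases Nat.lt_or_ge n.natAbs 2 with h | h
    · have : n.natAbs = 1 := by omega
      rw [this]; norm_num
    · have h2 : (2 : ℝ) ≤ n.natAbs := by exact_mod_cast h
      nlinarith
  rw [hcast]
  have hπy : 0 < π * y := mul_pos pi_pos hy
  nlinarith [hm, hsq]

/-- The dominating series `1 + Σ_{n ≠ 0} u^{3|n|-2}` sums to `1 + 2u/(1 - u³)`. [folklore] -/
theorem hasSum_thetaMajorant {u : ℝ} (hu0 : 0 ≤ u) (hu1 : u < 1) :
    HasSum (fun n : ℤ ↦ if n = 0 then (1 : ℝ) else u ^ (3 * n.natAbs - 2))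
      (u / (1 - u ^ 3) + 1 + u / (1 - u ^ 3)) := by
  have hu3 : u ^ 3 < 1 := pow_lt_one₀ hu0 hu1 (by norm_num)
  have hg : HasSum (fun k : ℕ ↦ u * (u ^ 3) ^ k) (u / (1 - u ^ 3)) := by
    rw [div_eq_mul_inv]
    exact (hasSum_geometric_of_lt_one (pow_nonneg hu0 3) hu3).mul_left u
  have hpos : ∀ k : ℕ, (fun n : ℤ ↦ if n = 0 then (1 : ℝ) else u ^ (3 * n.natAbs - 2))
      ((k : ℤ) + 1) = u * (u ^ 3) ^ k := by
    intro k
    have h1 : ((k : ℤ) + 1) ≠ 0 := by omega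
    have h2 : ((k : ℤ) + 1).natAbs = k + 1 := by omega
    simp only [h1, if_false, h2]
    rw [← pow_mul, ← pow_succ']
    congr 1
  have hneg : ∀ k : ℕ, (fun n : ℤ ↦ if n = 0 then (1 : ℝ) else u ^ (3 * n.natAbs - 2))
      (-((k : ℤ) + 1)) = u * (u ^ 3) ^ k := by
    intro k
    have h1 : (-((k : ℤ) + 1)) ≠ 0 := by omega
    have h2 : (-((k : ℤ) + 1)).natAbs = k + 1 := by omega
    simp only [h1, if_false, h2]
    rw [← pow_mul, ← pow_succ']
    congr 1
  have h := HasSum.of_add_one_of_neg_add_one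
    (f := fun n : ℤ ↦ if n = 0 then (1 : ℝ) else u ^ (3 * n.natAbs - 2))
    (by simpa only [hpos] using hg) (by simpa only [hneg] using hg)
  simpa using h

/-- **`θ₃(iy) ≤ 1 + 2u/(1 - u³)`**, `u = e^{-πy}`. [folklore] -/
theorem theta3_re_le (hy : 0 < y) :
    (theta3 (I * y)).re ≤ 1 + 2 * (rexp (-(π * y)) / (1 - rexp (-(π * y)) ^ 3)) := by
  set u := rexp (-(π * y)) with hu
  have hu0 : 0 ≤ u := (Real.exp_pos _).le
  have hu1 : u < 1 := Real.exp_lt_one_iff.mpr (by nlinarith [mul_pos pi_pos hy])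
  have h := hasSum_le (f := fun n : ℤ ↦ rexp (-π * (n : ℝ) ^ 2 * y))
    (g := fun n : ℤ ↦ if n = 0 then (1 : ℝ) else u ^ (3 * n.natAbs - 2)) ?_
    (hasSum_theta3_I_mul_re hy) (hasSum_thetaMajorant hu0 hu1)
  · linarith
  intro n
  by_cases hn : n = 0
  · simp [hn]
  · simp only [hn, if_false]
    exact exp_sq_le_majorant hy hn

/-- **`θ₄(iy) ≥ 2 - θ₃(iy)`** (`θ₄ = 1 + Σ_{n≠0} (-1)ⁿ e^{-πn²y} ≥ 1 - Σ_{n≠0} e^{-πn²y}`).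
[folklore] -/
theorem two_sub_theta3_re_le_theta4_re (hy : 0 < y) :
    2 - (theta3 (I * y)).re ≤ (theta4 (I * y)).re := by
  have h3 := hasSum_theta3_I_mul_re hy
  have hs : HasSum (fun n : ℤ ↦ -rexp (-π * (n : ℝ) ^ 2 * y) + if n = 0 then (2 : ℝ) else 0)
      (-(theta3 (I * y)).re + 2) := h3.neg.add (hasSum_ite_eq 0 2)
  have h := hasSum_le ?_ hs (hasSum_theta4_I_mul_re hy)
  · linarith
  intro n
  by_cases hn : n = 0
  · subst hn
    simp [jacobiTheta₂_term]
    norm_num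
  · simp only [hn, if_false, add_zero]
    have h1 := Complex.abs_re_le_norm (jacobiTheta₂_term n (1 / 2 : ℂ) (I * y))
    rw [norm_jacobiTheta₂_term_half_I_mul] at h1
    exact (abs_le.mp h1).1

/-! ### Numerical constants -/

/-- `e^{π} ≤ 23.2`. [folklore] -/
theorem rexp_pi_le : rexp π ≤ 23.2 := by
  have hπ : π ≤ 3 + 0.1416 := by have := pi_lt_d4; linarith
  have h1 : rexp π ≤ rexp (3 + 0.1416) := Real.exp_le_exp.mpr hπ
  rw [Real.exp_add, show (3 : ℝ) = 1 + 1 + 1 by norm_num, Real.exp_add, Real.exp_add] at h1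
  have he := Real.exp_one_lt_d9
  have he0 := Real.exp_pos (1 : ℝ)
  have hsmall : rexp 0.1416 ≤ 1.1523 := by
    have h := Real.exp_bound' (x := 0.1416) (by norm_num) (by norm_num) (n := 3) (by norm_num)
    refine h.trans ?_
    simp only [Finset.sum_range_succ, Finset.sum_range_zero, Nat.factorial]
    norm_num
  have h3 : rexp 1 * rexp 1 * rexp 1 ≤ 2.7182818286 ^ 3 := by
    have : rexp 1 * rexp 1 * rexp 1 = rexp 1 ^ 3 := by ring
    rw [this]
    exact pow_le_pow_left₀ he0.le he.le 3
  calc rexp π ≤ rexp 1 * rexp 1 * rexp 1 * rexp 0.1416 := h1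
    _ ≤ 2.7182818286 ^ 3 * 1.1523 := by
        apply mul_le_mul h3 hsmall (Real.exp_pos _).le (by positivity)
    _ ≤ 23.2 := by norm_num

/-- `e^{-π} ≥ 0.043`. [folklore] -/
theorem le_rexp_neg_pi : 0.043 ≤ rexp (-π) := by
  rw [Real.exp_neg, le_inv_comm₀ (by norm_num) (Real.exp_pos _)]
  exact rexp_pi_le.trans (by norm_num)

/-- `e^{4π/5} ≥ 12.2`. [folklore] -/
theorem le_rexp_four_pi_div_five : 12.2 ≤ rexp (4 * π / 5) := by
  have hπ : (2.51327 : ℝ) ≤ 4 * π / 5 := by have := pi_gt_d6; linarith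
  refine le_trans ?_ (Real.exp_le_exp.mpr hπ)
  have h := Real.sum_le_exp_of_nonneg (x := 2.51327) (by norm_num) 8
  refine le_trans ?_ h
  simp only [Finset.sum_range_succ, Finset.sum_range_zero, Nat.factorial]
  norm_num

/-- `e^{4π/5} ≤ 12.5`. [folklore] -/
theorem rexp_four_pi_div_five_le : rexp (4 * π / 5) ≤ 12.5 := by
  have hπ : 4 * π / 5 ≤ 2 + 0.51328 := by have := pi_lt_d6; linarith
  refine (Real.exp_le_exp.mpr hπ).trans ?_
  rw [Real.exp_add, show (2 : ℝ) = 1 + 1 by norm_num, Real.exp_add]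
  have he := Real.exp_one_lt_d9
  have he0 := Real.exp_pos (1 : ℝ)
  have hsmall : rexp 0.51328 ≤ 1.6712 := by
    have h := Real.exp_bound' (x := 0.51328) (by norm_num) (by norm_num) (n := 4) (by norm_num)
    refine h.trans ?_
    simp only [Finset.sum_range_succ, Finset.sum_range_zero, Nat.factorial]
    norm_num
  have h2 : rexp 1 * rexp 1 ≤ 2.7182818286 ^ 2 := by
    rw [← pow_two]
    exact pow_le_pow_left₀ he0.le he.le 2
  calc rexp 1 * rexp 1 * rexp 0.51328 ≤ 2.7182818286 ^ 2 * 1.6712 :=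
        mul_le_mul h2 hsmall (Real.exp_pos _).le (by positivity)
    _ ≤ 12.5 := by norm_num

/-- For `y ≥ 4/5`: `u = e^{-πy} ≤ 0.082`. [folklore] -/
theorem exp_neg_pi_mul_le (hy : 4 / 5 ≤ y) : rexp (-(π * y)) ≤ 0.082 := by
  have h1 : rexp (-(π * y)) ≤ rexp (-(4 * π / 5)) :=
    Real.exp_le_exp.mpr (by nlinarith [pi_pos])
  refine h1.trans ?_
  rw [Real.exp_neg, inv_le_comm₀ (Real.exp_pos _) (by norm_num)]
  exact le_trans (by norm_num) le_rexp_four_pi_div_five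

/-- For `y ≤ 1`: `e^{-πy} ≥ 0.043`. [folklore] -/
theorem le_exp_neg_pi_mul (hy : y ≤ 1) : 0.043 ≤ rexp (-(π * y)) :=
  le_rexp_neg_pi.trans (Real.exp_le_exp.mpr (by nlinarith [pi_pos]))

/-- For `y ≥ 4/5`: `θ₃(iy) ≤ 1.1641`. [folklore] -/
theorem theta3_re_le_const (hy : 4 / 5 ≤ y) : (theta3 (I * y)).re ≤ 1.1641 := by
  have hy0 : 0 < y := by linarith
  have h := theta3_re_le hy0
  set u := rexp (-(π * y))
  have hu0 : 0 ≤ u := (Real.exp_pos _).le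
  have hu1 : u ≤ 0.082 := exp_neg_pi_mul_le hy
  have hu3 : u ^ 3 ≤ 0.082 ^ 3 := pow_le_pow_left₀ hu0 hu1 3
  have hden : 0 < 1 - u ^ 3 := by nlinarith
  have hfrac : u / (1 - u ^ 3) ≤ 0.082 / (1 - 0.082 ^ 3) := by
    rw [div_le_div_iff₀ hden (by norm_num)]
    nlinarith
  have : (0.082 : ℝ) / (1 - 0.082 ^ 3) ≤ 0.08205 := by norm_num
  linarith

/-- For `4/5 ≤ y`: `θ₄(iy) ≥ 0.8359`. [folklore] -/
theorem const_le_theta4_re (hy : 4 / 5 ≤ y) : 0.8359 ≤ (theta4 (I * y)).re := by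
  have hy0 : 0 < y := by linarith
  have := two_sub_theta3_re_le_theta4_re hy0
  have := theta3_re_le_const hy
  linarith

/-- For `y ≤ 1`: `θ₂(iy)⁴ ≥ 16 e^{-πy} ≥ 0.688`. [folklore] -/
theorem const_le_theta2_re_pow_four (hy0 : 0 < y) (hy : y ≤ 1) :
    0.688 ≤ (theta2 (I * y)).re ^ 4 := by
  have h2 := two_mul_exp_le_theta2_re hy0
  have h4 : (2 * rexp (-(π * y / 4))) ^ 4 ≤ (theta2 (I * y)).re ^ 4 :=
    pow_le_pow_left₀ (by positivity) h2 4
  have he : (2 * rexp (-(π * y / 4))) ^ 4 = 16 * rexp (-(π * y)) := by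
    rw [mul_pow, ← Real.exp_nat_mul]
    congr 1
    · norm_num
    · congr 1
      push_cast
      ring
  rw [he] at h4
  have := le_exp_neg_pi_mul hy
  linarith

/-! ### Javanpeykar's Lemma 4.4.1: `|q dλ/dq| = λ θ₄⁴ ≥ 3/20` on `4/5 ≤ y ≤ 1` -/

/-- **The key estimate**: for `4/5 ≤ y ≤ 1`,
`θ₂(iy)⁴ θ₄(iy)⁴ / θ₃(iy)⁴ ≥ 3/20` (i.e. `λ(iy) θ₄(iy)⁴ ≥ 3/20`).
[cite: Javanpeykar2014, Lemma 4.4.1 (proof: "It suffices to show that |q dλ/dq| ≥ 3/20")] -/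
theorem three_twentieths_le_thetaQuot (hy : 4 / 5 ≤ y) (hy1 : y ≤ 1) :
    3 / 20 ≤ (theta2 (I * y)).re ^ 4 * (theta4 (I * y)).re ^ 4 / (theta3 (I * y)).re ^ 4 := by
  have hy0 : 0 < y := by linarith
  have h2 := const_le_theta2_re_pow_four hy0 hy1
  have h4 := const_le_theta4_re hy
  have h3 := theta3_re_le_const hy
  have h3pos := theta3_I_mul_re_pos hy0
  have h44 : (0.8359 : ℝ) ^ 4 ≤ (theta4 (I * y)).re ^ 4 := pow_le_pow_left₀ (by norm_num) h4 4
  have h34 : (theta3 (I * y)).re ^ 4 ≤ 1.1641 ^ 4 := pow_le_pow_left₀ h3pos.le h3 4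
  rw [le_div_iff₀ (pow_pos h3pos 4)]
  have hprod : (0.688 : ℝ) * 0.8359 ^ 4 ≤ (theta2 (I * y)).re ^ 4 * (theta4 (I * y)).re ^ 4 :=
    mul_le_mul h2 h44 (by positivity) (by linarith)
  nlinarith

/-- **Javanpeykar 2014, Lemma 4.4.1, in closed form.** For `4/5 ≤ y ≤ 1`,
`|q dλ/dq|(iy) = |λ'(iy)|/π ≥ 3/20`. [cite: Javanpeykar2014, Lemma 4.4.1] -/
theorem three_twentieths_le_norm_deriv_modularLambda_div_pi (hy : 4 / 5 ≤ y) (hy1 : y ≤ 1) :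
    3 / 20 ≤ ‖deriv modularLambda (I * y)‖ / π := by
  rw [norm_deriv_modularLambda_I_mul (by linarith), mul_div_cancel_left₀ _ pi_ne_zero]
  exact three_twentieths_le_thetaQuot hy hy1

/-- `e^{-2} ≤ 3/20`. [folklore] -/
theorem rexp_neg_two_le : rexp (-2) ≤ 3 / 20 := by
  rw [Real.exp_neg, inv_le_comm₀ (Real.exp_pos _) (by norm_num)]
  have h := Real.sum_le_exp_of_nonneg (x := 2) (by norm_num) 5
  refine le_trans ?_ h
  simp only [Finset.sum_range_succ, Finset.sum_range_zero, Nat.factorial]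
  norm_num

/-- **Javanpeykar 2014, Lemma 4.4.1** ("for any real number `4/5 ≤ y ≤ 1`,
`-log|Σ n aₙ qⁿ(iy)| ≤ 2`", with `Σ n aₙ qⁿ = q dλ/dq = λ'(τ)/(πi)`), closed form.
[cite: Javanpeykar2014, Lemma 4.4.1] -/
theorem neg_log_norm_deriv_modularLambda_div_pi_le (hy : 4 / 5 ≤ y) (hy1 : y ≤ 1) :
    -Real.log (‖deriv modularLambda (I * y)‖ / π) ≤ 2 := by
  have h := (rexp_neg_two_le.trans (three_twentieths_le_norm_deriv_modularLambda_div_pi hy hy1))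
  have hpos : 0 < ‖deriv modularLambda (I * y)‖ / π := lt_of_lt_of_le (Real.exp_pos _) h
  have := Real.log_le_log (Real.exp_pos _) h
  rw [Real.log_exp] at this
  linarith

/-- **Javanpeykar 2014, Lemma 4.4.1, as printed.** Let `λ(τ) = Σₙ aₙ qⁿ(τ)`, `q(τ) = e^{πiτ}`,
be the `q`-expansion of `λ` on `ℍ` (here `aₙ = 16 · (qExpansion 2 (λ/16))ₙ`, the coefficients
of `hasSum_qExpansion_modularLambda_div_sixteen`). Then for every real `4/5 ≤ y ≤ 1`,
`-log |Σₙ n aₙ qⁿ(iy)| ≤ 2`. (The paper's proof goes through the product formula for `λ`;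
here `Σ n aₙ qⁿ = q dλ/dq = λ θ₄⁴` by the derivative formula `λ' = πi λ θ₄⁴`, and the thetanulls are
bounded termwise on the axis.) [cite: Javanpeykar2014, Lemma 4.4.1] -/
theorem neg_log_norm_tsum_le_two (hy : 4 / 5 ≤ y) (hy1 : y ≤ 1) :
    -Real.log ‖∑' n : ℕ, (n : ℂ) *
        (16 * (UpperHalfPlane.qExpansion 2
          (fun τ : UpperHalfPlane ↦ modularLambda τ / 16)).coeff n) *
            cexp (π * I * (I * y)) ^ n‖ ≤ 2 := by
  have hy0 : 0 < y := by linarith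
  rw [(hasSum_natCast_mul_coeff_mul_exp (im_I_mul_pos hy0)).tsum_eq, norm_div, norm_mul,
    Complex.norm_real, Complex.norm_I, mul_one, Real.norm_of_nonneg pi_pos.le]
  exact neg_log_norm_deriv_modularLambda_div_pi_le hy hy1

/-- **`λ(4i/5) > 2/3`** (`θ₂(4i/5)⁴ ≥ 16 e^{-4π/5} ≥ 1.28` and `θ₃(4i/5)⁴ ≤ 1.1641⁴`; so
`Im λ⁻¹(2/3) > 4/5`, cf. "`λ⁻¹(2/3) ≈ 0.85i`" in the proof of [cite: Javanpeykar2014, Thm. 4.5.1]).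
-/
theorem two_thirds_lt_modularLambda_re_four_fifths :
    2 / 3 < (modularLambda (I * (4 / 5 : ℝ))).re := by
  have hy0 : (0 : ℝ) < 4 / 5 := by norm_num
  rw [modularLambda_I_mul_re hy0]
  have h3pos := theta3_I_mul_re_pos hy0
  have h3 := theta3_re_le_const (y := 4 / 5) le_rfl
  have h34 : (theta3 (I * (4 / 5 : ℝ))).re ^ 4 ≤ 1.1641 ^ 4 := pow_le_pow_left₀ h3pos.le h3 4
  have h2 := two_mul_exp_le_theta2_re hy0
  have h24 : (2 * rexp (-(π * (4 / 5) / 4))) ^ 4 ≤ (theta2 (I * (4 / 5 : ℝ))).re ^ 4 :=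
    pow_le_pow_left₀ (by positivity) h2 4
  have he : (2 * rexp (-(π * (4 / 5) / 4))) ^ 4 = 16 * rexp (-(4 * π / 5)) := by
    rw [mul_pow, ← Real.exp_nat_mul]
    congr 1
    · norm_num
    · congr 1
      push_cast
      ring
  have hu : (0.08 : ℝ) ≤ rexp (-(4 * π / 5)) := by
    rw [Real.exp_neg, le_inv_comm₀ (by norm_num) (Real.exp_pos _)]
    exact rexp_four_pi_div_five_le.trans (by norm_num)
  rw [he] at h24
  rw [lt_div_iff₀ (pow_pos h3pos 4)]
  nlinarith

/-- **The preimage of `[1/2, 2/3]` under `y ↦ λ(iy)` lies in `[4/5, 1]`**: if `y > 0` and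
`1/2 ≤ λ(iy) ≤ 2/3` then `4/5 ≤ y ≤ 1` (so Lemma 4.4.1 applies at `τ = λ⁻¹(a)` for
`a ∈ [1/2, 2/3]`, as in the proof of Thm. 4.5.1–4.5.2 of the paper: "Note that
`λ⁻¹(2/3) ≈ 0.85i`"). [cite: Javanpeykar2014, proof of Thm. 4.5.1] -/
theorem mem_Icc_of_modularLambda_re_mem_Icc (hy : 0 < y)
    (h : (modularLambda (I * y)).re ∈ Set.Icc (1 / 2 : ℝ) (2 / 3)) : y ∈ Set.Icc (4 / 5 : ℝ) 1 := by
  have hanti := strictAntiOn_modularLambda_I_mul_re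
  constructor
  · by_contra hlt
    have hlt' : y < 4 / 5 := not_le.mp hlt
    have := hanti hy (show (0 : ℝ) < 4 / 5 by norm_num) hlt'
    have h23 := two_thirds_lt_modularLambda_re_four_fifths
    simp only at this
    linarith [h.2]
  · by_contra hlt
    have hlt' : 1 < y := not_le.mp hlt
    have := hanti (show (0 : ℝ) < 1 by norm_num) hy hlt'
    have h1 : (modularLambda (I * (1 : ℝ))).re = 1 / 2 := by
      rw [ofReal_one, mul_one, modularLambda_I]
      norm_num
    simp only [h1] at this
    linarith [h.1]

end ModularLambda

end Literature.NumberTheory.Automorphic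

end
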